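import Summits.ValiantsHypothesis.ValiantsHypothesis.Theorems.KPlusLogSqLawTridiagonalRealStaticUnitRecessiveCount

/-!
# Route «KPlusLogSqLaw», crux `WeakLifting` (stmt-ValiantsHypothesis-19561) — REAL side of the tridiagonal sector:
# the UNIT-COEFFICIENT sub-sector — the sign table just ABOVE the resonance, the resonance zero, and the Sturm-count cap (all sizes)

HONEST FRAMING.  Helper theorems (`--supports stmt-ValiantsHypothesis-19561 --as helper`), seat val-sym-lift-p1 (g19), cell `pub-symmetroid`,
2026-08-28; right-sided companion of g18's `…UnitRecessiveCount` (p638066: sign table just BELOW `1`, `V(1⁻) = ⌊m/3⌋`).  Continuants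
`D_k = pathDet (fun _ => 1) d (fun _ => 1) f k`, Sturm count `V(x) = #{k < m : D_k(x)D_{k+1}(x) < 0}`.  Proved here (all sizes, all exponents):
* `eventually_pos_mul_of_root_right`, `eventually_pos_mul_of_ne_right`, `exists_delta_of_eventually_right` (local sign lemmas right of a point);
* **SIGN TABLE ABOVE THE RESONANCE** (`eventually_signTable_above_one`): all slopes positive ⇒ just above `1` the continuant `D_k` has the sign `+`
  iff `(k+1) mod 6 < 3` (values at `1`: `1, 1, 0, −1, −1, 0, …`; at a resonance zero `k ≡ 2 (3)` the Jacobi step `D_{k−1}(1)D_k′(1) < 0` of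
  p638066 decides), hence (`sturmCount_of_signTable_above`, `card_filter_mod_three_one`) **`V(1⁺) = ⌊(m+1)/3⌋`**;
* the RESONANCE ZERO (`rootMultiplicity_one_eq`): `x = 1` is a zero of `D_m` iff `m ≡ 2 (mod 3)`, and then it is simple — root multiplicity
  `[m ≡ 2 (3)]`; so the zeros in `(0,1]` number `⌊(m+1)/3⌋` whenever those in `(0,1)` number `⌊m/3⌋`;
* **STURM-COUNT CAP** (`sturmCount_le_half`): at every `x > 0` with no vanishing continuant, `V(x) ≤ ⌊m/2⌋` (the first product is positive and two
  consecutive negative pivot products are impossible: `pivotProd_succ_pos_of_neg`).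
Nothing here is an upper law for the register (α NO MOVER); nothing bears on `WeakLifting` / `TropicalB` (stmt-19771) in their windows, Conjecture B,
the Door-A registers, `MatrixDescartes` (stmt-18050) or VP ≠ VNP.
[this seat; folklore: Sturm sequences of Jacobi matrices]
-/

-- `Summit.ValiantsHypothesis.ValiantsHypothesis.…` repeats a component by the D-0017 layout (single-conjunct summit); the name is mandated.
set_option linter.dupNamespace false
set_option autoImplicit false

namespace Summit.ValiantsHypothesis.ValiantsHypothesis.Theorems.KPlusLogSqLaw
namespace StaticTridiagonalRealUnit

open Real Finset Polynomial Filter Topology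
open Summit.ValiantsHypothesis.ValiantsHypothesis.Theorems.KPlusLogSqLaw.StaticTridiagonalRealPotential (pathDet)

variable (d : ℕ → ℕ) (f : ℕ → ℕ)

/-! ### 1. Local sign lemmas just right of a point -/

/-- a simple zero with `c·p′(1) > 0` has `c·p(x) > 0` just right of `1`. [folklore] -/
theorem eventually_pos_mul_of_root_right (p : ℝ[X]) (c : ℝ) (h1 : p.eval 1 = 0) (hd : 0 < c * (derivative p).eval 1) :
    ∀ᶠ x in 𝓝[>] (1 : ℝ), 0 < c * p.eval x := by
  have hder : HasDerivAt (fun x => (C c * p).eval x) (c * (derivative p).eval 1) 1 := by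
    have := (C c * p).hasDerivAt 1
    rwa [derivative_mul, derivative_C, zero_mul, zero_add, eval_mul, eval_C] at this
  rw [hasDerivAt_iff_tendsto_slope] at hder
  have hlt : ∀ᶠ x in 𝓝[≠] (1 : ℝ), 0 < (x - 1)⁻¹ • ((C c * p).eval x - (C c * p).eval 1) := hder (Ioi_mem_nhds hd)
  have hlt' : ∀ᶠ x in 𝓝[>] (1 : ℝ), 0 < (x - 1)⁻¹ • ((C c * p).eval x - (C c * p).eval 1) :=
    hlt.filter_mono (nhdsWithin_mono _ fun y hy => ne_of_gt hy)
  have hmem : ∀ᶠ x in 𝓝[>] (1 : ℝ), 1 < x := eventually_nhdsWithin_of_forall fun y hy => hy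
  filter_upwards [hlt', hmem] with x hx hx1
  rw [eval_mul, eval_C, eval_mul, eval_C, h1, mul_zero, sub_zero, smul_eq_mul] at hx
  have hpos : 0 < (x - 1)⁻¹ := inv_pos.2 (by linarith)
  exact (pos_iff_pos_of_mul_pos hx).1 hpos

/-- a polynomial keeps the sign of a non-zero value just right of the point. [folklore] -/
theorem eventually_pos_mul_of_ne_right (p : ℝ[X]) (h1 : p.eval 1 ≠ 0) :
    ∀ᶠ x in 𝓝[>] (1 : ℝ), 0 < p.eval 1 * p.eval x := by
  have hcont : ContinuousAt (fun x => p.eval 1 * p.eval x) 1 := by fun_prop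
  have hpos : 0 < p.eval 1 * p.eval 1 := mul_self_pos.2 h1
  have h := hcont.eventually (Ioi_mem_nhds hpos)
  exact h.filter_mono nhdsWithin_le_nhds

/-- extraction of an explicit right neighbourhood. [bookkeeping] -/
theorem exists_delta_of_eventually_right {P : ℝ → Prop} (h : ∀ᶠ x in 𝓝[>] (1 : ℝ), P x) :
    ∃ δ > 0, ∀ x, 1 < x → x < 1 + δ → P x := by
  rw [eventually_nhdsWithin_iff, Metric.eventually_nhds_iff] at h
  obtain ⟨ε, hε, hball⟩ := h
  refine ⟨ε, hε, fun x hx1 hx2 => hball ?_ hx1⟩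
  rw [Real.dist_eq, abs_lt]
  constructor <;> linarith

/-! ### 2. The sign table just above the resonance -/

/-- **sign table near `1⁺`**: for every `k ≤ m`, just above `1` the continuant `D_k` has the sign `+` if `(k+1) mod 6 < 3` and `−` otherwise
(all slopes positive). [this file] -/
theorem eventually_signTable_above_one (m : ℕ) (hslope : ∀ k, k + 1 < m → d k + d (k + 1) < 2 * f k) (k : ℕ) (hk : k ≤ m) :
    ∀ᶠ x in 𝓝[>] (1 : ℝ), 0 < (if (k + 1) % 6 < 3 then (1 : ℝ) else -1) * (pathDet (fun _ => (1 : ℝ)) d (fun _ => (1 : ℝ)) f k).eval x := by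
  by_cases hk3 : k % 3 = 2
  · -- resonance zero: first-order sign, opposite to the left side
    obtain ⟨n, rfl⟩ : ∃ n, k = n + 2 := ⟨k - 2, by omega⟩
    have hroot : (pathDet (fun _ => (1 : ℝ)) d (fun _ => (1 : ℝ)) f (n + 2)).eval 1 = 0 := by
      rw [eval_one_eq_sign, if_pos hk3]
    have hder := prev_mul_deriv_one_neg d f n (fun j hj => hslope j (by omega)) hroot
    have hprev : (pathDet (fun _ => (1 : ℝ)) d (fun _ => (1 : ℝ)) f (n + 1)).eval 1 = -(if (n + 2 + 1) % 6 < 3 then (1 : ℝ) else -1) := by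
      rw [eval_one_eq_sign, if_neg (by omega)]
      by_cases h : (n + 2 + 1) % 6 < 3
      · rw [if_pos h, if_neg (by omega)]
      · rw [if_neg h, if_pos (by omega), neg_neg]
    rw [hprev, neg_mul] at hder
    exact eventually_pos_mul_of_root_right _ _ hroot (by linarith)
  · -- non-zero value at `1`: continuity
    have hval : (pathDet (fun _ => (1 : ℝ)) d (fun _ => (1 : ℝ)) f k).eval 1 = if (k + 1) % 6 < 3 then (1 : ℝ) else -1 := by
      rw [eval_one_eq_sign, if_neg hk3]
      by_cases h : (k + 1) % 6 < 3
      · rw [if_pos h, if_pos (by omega)]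
      · rw [if_neg h, if_neg (by omega)]
    have hne : (pathDet (fun _ => (1 : ℝ)) d (fun _ => (1 : ℝ)) f k).eval 1 ≠ 0 := by
      rw [hval]; split_ifs <;> norm_num
    have h := eventually_pos_mul_of_ne_right _ hne
    rw [hval] at h
    exact h

/-- the number of indices `k < m` with `k ≡ 1 (mod 3)` is `⌊(m+1)/3⌋`. [bookkeeping] -/
theorem card_filter_mod_three_one (m : ℕ) : (Finset.univ.filter fun k : Fin m => (k : ℕ) % 3 = 1).card = (m + 1) / 3 := by
  rw [Finset.card_filter, Fin.sum_univ_eq_sum_range (fun k => if k % 3 = 1 then 1 else 0) m]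
  induction m with
  | zero => simp
  | succ m ih =>
    rw [sum_range_succ, ih]
    split_ifs with h <;> omega

/-- **Sturm count from the upper sign table**: if every `D_k(x)` (`k ≤ m`) has the sign of the table above `1`, the Sturm count at `x` is
`⌊(m+1)/3⌋` and no `D_k(x)` vanishes. [this file] -/
theorem sturmCount_of_signTable_above (m : ℕ) (x : ℝ)
    (hsign : ∀ k, k ≤ m → 0 < (if (k + 1) % 6 < 3 then (1 : ℝ) else -1) * (pathDet (fun _ => (1 : ℝ)) d (fun _ => (1 : ℝ)) f k).eval x) :
    (Finset.univ.filter fun k : Fin m =>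
        (pathDet (fun _ => (1 : ℝ)) d (fun _ => (1 : ℝ)) f k).eval x * (pathDet (fun _ => (1 : ℝ)) d (fun _ => (1 : ℝ)) f (k + 1)).eval x < 0).card =
      (m + 1) / 3 ∧ ∀ k, k ≤ m → (pathDet (fun _ => (1 : ℝ)) d (fun _ => (1 : ℝ)) f k).eval x ≠ 0 := by
  have hne : ∀ k, k ≤ m → (pathDet (fun _ => (1 : ℝ)) d (fun _ => (1 : ℝ)) f k).eval x ≠ 0 := by
    intro k hk h0
    have := hsign k hk
    rw [h0, mul_zero] at this
    exact lt_irrefl _ this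
  refine ⟨?_, hne⟩
  rw [← card_filter_mod_three_one m]
  congr 1
  refine Finset.filter_congr fun k _ => ?_
  have h1 := hsign k (by omega)
  have h2 := hsign (k + 1) (by omega)
  -- the product has the sign of `σ_k σ_{k+1}`, which is negative exactly when `k ≡ 1 (mod 3)`
  have key : (((k : ℕ) + 1) % 6 < 3 ↔ ((k : ℕ) + 1 + 1) % 6 < 3) ↔ ¬ ((k : ℕ) % 3 = 1) := by omega
  constructor
  · intro hlt
    by_contra h3
    have hsame : (((k : ℕ) + 1) % 6 < 3 ↔ ((k : ℕ) + 1 + 1) % 6 < 3) := key.2 h3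
    by_cases ha : ((k : ℕ) + 1) % 6 < 3
    · have hb := hsame.1 ha
      rw [if_pos ha, one_mul] at h1
      rw [if_pos hb, one_mul] at h2
      nlinarith
    · have hb : ¬ ((k : ℕ) + 1 + 1) % 6 < 3 := fun hb => ha (hsame.2 hb)
      rw [if_neg ha] at h1
      rw [if_neg hb] at h2
      nlinarith
  · intro h3
    have hdiff : ¬ (((k : ℕ) + 1) % 6 < 3 ↔ ((k : ℕ) + 1 + 1) % 6 < 3) := fun h => key.1 h h3
    by_cases ha : ((k : ℕ) + 1) % 6 < 3
    · have hb : ¬ ((k : ℕ) + 1 + 1) % 6 < 3 := fun hb => hdiff ⟨fun _ => hb, fun _ => ha⟩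
      rw [if_pos ha, one_mul] at h1
      rw [if_neg hb] at h2
      nlinarith
    · have hb : ((k : ℕ) + 1 + 1) % 6 < 3 := by
        by_contra hb; exact hdiff ⟨fun h => absurd h ha, fun h => absurd h hb⟩
      rw [if_neg ha] at h1
      rw [if_pos hb, one_mul] at h2
      nlinarith

/-- **`V(1⁺) = ⌊(m+1)/3⌋`**: all slopes positive ⇒ there is `δ > 0` such that at every `x ∈ (1, 1+δ)` the Sturm count is `⌊(m+1)/3⌋` and no
continuant `D_k` (`k ≤ m`) vanishes. [this file] -/
theorem exists_sturmCount_above_one (m : ℕ) (hslope : ∀ k, k + 1 < m → d k + d (k + 1) < 2 * f k) :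
    ∃ δ > 0, ∀ x, 1 < x → x < 1 + δ →
      (Finset.univ.filter fun k : Fin m =>
        (pathDet (fun _ => (1 : ℝ)) d (fun _ => (1 : ℝ)) f k).eval x * (pathDet (fun _ => (1 : ℝ)) d (fun _ => (1 : ℝ)) f (k + 1)).eval x < 0).card =
      (m + 1) / 3 ∧ ∀ k, k ≤ m → (pathDet (fun _ => (1 : ℝ)) d (fun _ => (1 : ℝ)) f k).eval x ≠ 0 := by
  have hev : ∀ᶠ x in 𝓝[>] (1 : ℝ), ∀ k ∈ range (m + 1),
      0 < (if (k + 1) % 6 < 3 then (1 : ℝ) else -1) * (pathDet (fun _ => (1 : ℝ)) d (fun _ => (1 : ℝ)) f k).eval x :=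
    (Finset.eventually_all (range (m + 1))).2 fun k hk =>
      eventually_signTable_above_one d f m hslope k (by rw [mem_range] at hk; omega)
  obtain ⟨δ, hδ, hnear⟩ := exists_delta_of_eventually_right hev
  exact ⟨δ, hδ, fun x hx1 hx2 => sturmCount_of_signTable_above d f m x fun k hk => hnear x hx1 hx2 k (by rw [mem_range]; omega)⟩

/-! ### 3. The resonance zero -/

/-- **THE RESONANCE ZERO**: all slopes positive ⇒ the root multiplicity of `D_m` at `x = 1` is `1` if `m ≡ 2 (mod 3)` and `0` otherwise
(values `1,1,0,−1,−1,0,…` at `1`; simplicity from the Jacobi step `D_{m−1}(1)·D_m′(1) < 0`, p638066). [this file] -/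
theorem rootMultiplicity_one_eq (m : ℕ) (hslope : ∀ k, k + 1 < m → d k + d (k + 1) < 2 * f k) :
    (pathDet (fun _ => (1 : ℝ)) d (fun _ => (1 : ℝ)) f m).rootMultiplicity 1 = if m % 3 = 2 then 1 else 0 := by
  by_cases hm : m % 3 = 2
  · rw [if_pos hm]
    obtain ⟨n, rfl⟩ : ∃ n, m = n + 2 := ⟨m - 2, by omega⟩
    have hroot : (pathDet (fun _ => (1 : ℝ)) d (fun _ => (1 : ℝ)) f (n + 2)).eval 1 = 0 := by
      rw [eval_one_eq_sign, if_pos hm]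
    have hder := prev_mul_deriv_one_neg d f n hslope hroot
    have hP0 : pathDet (fun _ => (1 : ℝ)) d (fun _ => (1 : ℝ)) f (n + 2) ≠ 0 := by
      intro h0
      rw [h0, derivative_zero, eval_zero, mul_zero] at hder
      exact lt_irrefl _ hder
    have hpos : 0 < (pathDet (fun _ => (1 : ℝ)) d (fun _ => (1 : ℝ)) f (n + 2)).rootMultiplicity 1 :=
      (rootMultiplicity_pos hP0).2 hroot
    have hle : ¬ 1 < (pathDet (fun _ => (1 : ℝ)) d (fun _ => (1 : ℝ)) f (n + 2)).rootMultiplicity 1 := by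
      rw [one_lt_rootMultiplicity_iff_isRoot hP0]
      rintro ⟨-, h2⟩
      rw [IsRoot.def] at h2
      rw [h2, mul_zero] at hder
      exact lt_irrefl _ hder
    omega
  · rw [if_neg hm]
    refine rootMultiplicity_eq_zero ?_
    rw [IsRoot.def, eval_one_eq_sign, if_neg hm]
    split_ifs <;> norm_num

/-! ### 4. The Sturm-count cap -/

/-- **no two consecutive negative pivot products** (any `x > 0`, any exponents): `D_kD_{k+1}(x) < 0 ⇒ D_{k+1}D_{k+2}(x) > 0`
(`D_{k+1}D_{k+2} = x^{d_{k+1}}D_{k+1}² − x^{2f_k}D_kD_{k+1}`). [folklore: LDLᵀ pivots] -/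
theorem pivotProd_succ_pos_of_neg (x : ℝ) (hx : 0 < x) (k : ℕ)
    (hneg : (pathDet (fun _ => (1 : ℝ)) d (fun _ => (1 : ℝ)) f k).eval x * (pathDet (fun _ => (1 : ℝ)) d (fun _ => (1 : ℝ)) f (k + 1)).eval x < 0) :
    0 < (pathDet (fun _ => (1 : ℝ)) d (fun _ => (1 : ℝ)) f (k + 1)).eval x * (pathDet (fun _ => (1 : ℝ)) d (fun _ => (1 : ℝ)) f (k + 2)).eval x := by
  rw [eval_unit_add_two d f x k]
  have h1 : (pathDet (fun _ => (1 : ℝ)) d (fun _ => (1 : ℝ)) f (k + 1)).eval x ≠ 0 := fun h => by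
    rw [h, mul_zero] at hneg; exact lt_irrefl _ hneg
  have hsq : 0 < (pathDet (fun _ => (1 : ℝ)) d (fun _ => (1 : ℝ)) f (k + 1)).eval x ^ 2 := by positivity
  nlinarith [pow_pos hx (d (k + 1)), pow_pos hx (2 * f k)]

/-- **STURM-COUNT CAP (all sizes)**: at every `x > 0` the Sturm count satisfies `V(x) ≤ ⌊m/2⌋` — the product `D_0D_1 = x^{d_0}` is positive and
negative products are isolated, so `k ↦ ⌊(k+1)/2⌋` injects the negative positions into `{1, …, ⌊m/2⌋}`. [this file] -/
theorem sturmCount_le_half (m : ℕ) (x : ℝ) (hx : 0 < x) :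
    (Finset.univ.filter fun k : Fin m =>
        (pathDet (fun _ => (1 : ℝ)) d (fun _ => (1 : ℝ)) f k).eval x * (pathDet (fun _ => (1 : ℝ)) d (fun _ => (1 : ℝ)) f (k + 1)).eval x < 0).card ≤
      m / 2 := by
  classical
  set S := Finset.univ.filter fun k : Fin m =>
    (pathDet (fun _ => (1 : ℝ)) d (fun _ => (1 : ℝ)) f k).eval x * (pathDet (fun _ => (1 : ℝ)) d (fun _ => (1 : ℝ)) f (k + 1)).eval x < 0 with hS
  have hP0 : 0 < (pathDet (fun _ => (1 : ℝ)) d (fun _ => (1 : ℝ)) f 0).eval x * (pathDet (fun _ => (1 : ℝ)) d (fun _ => (1 : ℝ)) f 1).eval x := by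
    obtain ⟨e0, e1⟩ := eval_unit_zero_one d f x
    rw [e0, e1, one_mul]; exact pow_pos hx _
  -- the injection `k ↦ ⌊(k+1)/2⌋` into `Icc 1 (m/2)`
  have hmap : ∀ k ∈ S, ((k : ℕ) + 1) / 2 ∈ Finset.Icc 1 (m / 2) := by
    intro k hk
    rw [hS, Finset.mem_filter] at hk
    have hk0 : (k : ℕ) ≠ 0 := fun h => by
      have := hk.2; rw [show (k : ℕ) = 0 from h] at this; exact absurd this (not_lt.2 hP0.le)
    rw [Finset.mem_Icc]
    constructor <;> omega
  have hinj : Set.InjOn (fun k : Fin m => ((k : ℕ) + 1) / 2) S := by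
    intro k₁ hk₁ k₂ hk₂ h
    simp only at h
    rw [Finset.mem_coe, hS, Finset.mem_filter] at hk₁ hk₂
    -- equal images and distinct positions would make the positions consecutive: two adjacent negative products
    by_contra hne
    have hne' : (k₁ : ℕ) ≠ k₂ := fun h' => hne (Fin.ext h')
    rcases Nat.lt_or_gt_of_ne hne' with hlt | hgt
    · have h21 : (k₂ : ℕ) = k₁ + 1 := by omega
      have := pivotProd_succ_pos_of_neg d f x hx k₁ hk₁.2
      rw [← h21, show (k₁ : ℕ) + 2 = k₂ + 1 by omega] at this
      linarith [hk₂.2]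
    · have h12 : (k₁ : ℕ) = k₂ + 1 := by omega
      have := pivotProd_succ_pos_of_neg d f x hx k₂ hk₂.2
      rw [← h12, show (k₂ : ℕ) + 2 = k₁ + 1 by omega] at this
      linarith [hk₁.2]
  calc S.card ≤ (Finset.Icc 1 (m / 2)).card := Finset.card_le_card_of_injOn _ hmap hinj
    _ = m / 2 := by simp

end StaticTridiagonalRealUnit
end Summit.ValiantsHypothesis.ValiantsHypothesis.Theorems.KPlusLogSqLaw
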